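import Summits.AtomisticToContinuum.HydrodynamicLimit.Theorems.JaynesSqueezeBlockGibbsMeasurableProfiles
import Summits.AtomisticToContinuum.HydrodynamicLimit.Theorems.JaynesSqueezeSqueezeToBlockGibbsIntensity
import Summits.AtomisticToContinuum.HydrodynamicLimit.Theorems.JaynesSqueezeSqueezeToBlockGibbsUniformLDA
import HarnessLib

/-!
# The block-constant reference of `JaynesSqueeze.BlockGibbs`, I: range, partition functions, kinetic energy
# (support for stmt-AtomisticToContinuum-13462)

`BlockGibbs` asks, eventually in `N` and for every `s ≤ t`, for block-constant parameters
`(ca, cu, cθ)` at scale `1/m` in the compact range `A⁻¹ ≤ ca ≤ A`, `Θ⁻¹ ≤ cθ ≤ Θ`, `‖cu‖ ≤ V` with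
`klDiv(lawAt Φ_N P_N s ‖ localGibbsLaw σ (ca ∘ idx m) (cu ∘ idx m) (cθ ∘ idx m) N Φ_N) ≤ δ(N+1)`,
`idx m x = (⌊m · repr x i⌋₊)ᵢ`. This file and its sequel `JaynesSqueezeBlockGibbsTransport` supply the
finite-`N` facts about that reference which every line to `BlockGibbs` (the squeeze
`SqueezeToBlockGibbs`, or a direct Yau-type argument) starts from. Here:

* block-constant profiles `c ∘ idx m` are measurable (`measurable_comp_blockIdx`; the block index itself,
  its range `range m ^ 3` and the blocks are treated in `JaynesSqueezeSqueezeToBlockGibbsIntensity`);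
* parameter triples in the `BlockGibbs` range: `1 ≤ A`, `|log a| ≤ log A`, and the UNIFORM quadratic
  velocity bound `|log prof(x,v)| ≤ C(A,Θ,V)(1 + ‖v‖²)` with the explicit constant
  `C = log A + 3/2 (log 2π + log Θ) + Θ(1 + V²)` (`abs_log_localGibbsProfile_le_of_bounds`), hence
  integrability of the empirical log-profile pairing along any measurable map given integrable
  kinetic energy (`integrable_logPair_comp_of_bounds`);
* comparison of configurational partition functions: `|log Z_a − log Z_b| ≤ (N+1) η` when
  `|log a − log b| ≤ η` (`abs_log_posPartition_sub_le`, the `σ ≤ 1/2` form of the log-Lipschitz estimate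
  of `JaynesSqueezeSqueezeToBlockGibbsUniformLDA`) — the price of replacing a profile by a block-constant
  approximant;
* the block reference of `BlockGibbs` is a probability measure (`isProbabilityMeasure_localGibbsLaw_blockRef`),
  so the `klDiv` in `BlockGibbs` is a genuine relative entropy, never the junk `klDiv μ 0 = ∞`.

No new definitions (the block index is written inline, as in the Theses file).
-/

noncomputable section

open MeasureTheory Filter Set Topology InformationTheory
open scoped ENNReal

namespace Summit.AtomisticToContinuum.HydrodynamicLimit.Theorems.BlockGibbsLine

open Literature.MathematicalPhysics.KineticTheory Literature.Analysis.FluidPDE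
open Literature.Analysis.FunctionSpaces

/-! ## The block index -/

/-- Any block-constant profile `x ↦ c (idx m x)` is measurable (the block index map is measurable,
`JaynesSqueezeSqueeze.measurable_blockIdx`, and its codomain is countable). [folklore] -/
theorem measurable_comp_blockIdx {α : Type*} [MeasurableSpace α] (c : (Fin 3 → ℕ) → α) (m : ℕ) :
    Measurable fun x : T3 => c (fun i : Fin 3 => ⌊(m : ℝ) * Torus.repr x i⌋₊) :=
  (measurable_of_countable c).comp (JaynesSqueezeSqueeze.measurable_blockIdx m)

/-! ## Parameter triples in the `BlockGibbs` range -/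

/-- A two-sided bound `A⁻¹ ≤ a ≤ A` with `A > 0` forces `1 ≤ A`. [folklore] -/
theorem one_le_of_inv_le_of_le {A a : ℝ} (hA : 0 < A) (h₁ : A⁻¹ ≤ a) (h₂ : a ≤ A) : 1 ≤ A := by
  have h : A⁻¹ ≤ A := h₁.trans h₂
  have h1 : (1 : ℝ) ≤ A * A := by
    calc (1 : ℝ) = A⁻¹ * A := (inv_mul_cancel₀ hA.ne').symm
      _ ≤ A * A := mul_le_mul_of_nonneg_right h hA.le
  nlinarith

/-- `A⁻¹ ≤ a ≤ A` gives `|log a| ≤ log A`. [folklore] -/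
theorem abs_log_le_log_of_bounds {A a : ℝ} (hA : 0 < A) (h₁ : A⁻¹ ≤ a) (h₂ : a ≤ A) :
    |Real.log a| ≤ Real.log A := by
  have ha : 0 < a := (inv_pos.2 hA).trans_le h₁
  rw [abs_le]
  constructor
  · rw [← Real.log_inv]
    exact Real.log_le_log (inv_pos.2 hA) h₁
  · exact Real.log_le_log ha h₂

/-- **Uniform quadratic velocity bound on the log-profile.** For parameters in the `BlockGibbs` range
`A⁻¹ ≤ a ≤ A`, `Θ⁻¹ ≤ θ ≤ Θ`, `‖u‖ ≤ V`:
`|log prof(x,v)| ≤ (log A + 3/2 (log 2π + log Θ) + Θ(1 + V²)) (1 + ‖v‖²)`; the constant depends on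
`(A, Θ, V)` only (not on the profiles, `N`, or the block scale). [folklore] -/
theorem abs_log_localGibbsProfile_le_of_bounds {A Θ V : ℝ} (hA : 0 < A) (hΘ : 0 < Θ)
    {a θ : T3 → ℝ} {u : T3 → V3} (ha : ∀ x, A⁻¹ ≤ a x ∧ a x ≤ A)
    (hθ : ∀ x, Θ⁻¹ ≤ θ x ∧ θ x ≤ Θ) (hu : ∀ x, ‖u x‖ ≤ V) (x : T3) (v : V3) :
    |Real.log (localGibbsProfile a u θ (x, v))| ≤
      (Real.log A + 3 / 2 * (Real.log (2 * Real.pi) + Real.log Θ) + Θ * (1 + V ^ 2)) * (1 + ‖v‖ ^ 2) := by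
  have hax : 0 < a x := (inv_pos.2 hA).trans_le (ha x).1
  have hθx : 0 < θ x := (inv_pos.2 hΘ).trans_le (hθ x).1
  have hA1 : 1 ≤ A := one_le_of_inv_le_of_le hA (ha x).1 (ha x).2
  have hΘ1 : 1 ≤ Θ := one_le_of_inv_le_of_le hΘ (hθ x).1 (hθ x).2
  have hlA : |Real.log (a x)| ≤ Real.log A := abs_log_le_log_of_bounds hA (ha x).1 (ha x).2
  have hlΘ : |Real.log (θ x)| ≤ Real.log Θ := abs_log_le_log_of_bounds hΘ (hθ x).1 (hθ x).2
  have hlogA : 0 ≤ Real.log A := Real.log_nonneg hA1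
  have hlogΘ : 0 ≤ Real.log Θ := Real.log_nonneg hΘ1
  have h2π : 0 ≤ Real.log (2 * Real.pi) :=
    Real.log_nonneg (by linarith [Real.pi_gt_three])
  have h2πθ : 0 < 2 * Real.pi * θ x := mul_pos (mul_pos two_pos Real.pi_pos) hθx
  -- the normalisation term
  have hnorm : Real.log ((2 * Real.pi * θ x) ^ (-(Module.finrank ℝ V3 : ℝ) / 2)) =
      -(3 / 2) * (Real.log (2 * Real.pi) + Real.log (θ x)) := by
    rw [Real.log_rpow h2πθ, finrank_euclideanSpace_fin,
      Real.log_mul (mul_pos two_pos Real.pi_pos).ne' hθx.ne']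
    push_cast
    ring
  have hB : |Real.log ((2 * Real.pi * θ x) ^ (-(Module.finrank ℝ V3 : ℝ) / 2))| ≤
      3 / 2 * (Real.log (2 * Real.pi) + Real.log Θ) := by
    rw [hnorm, abs_le]
    have := abs_le.1 hlΘ
    constructor <;> nlinarith [this.1, this.2]
  -- the quadratic term
  have hinv : (θ x)⁻¹ ≤ Θ := by
    have := (hθ x).1
    rwa [inv_le_comm₀ hΘ hθx] at this
  have hQ0 : 0 ≤ ‖v - u x‖ ^ 2 / (2 * θ x) := div_nonneg (sq_nonneg _) (by positivity)
  have hQ : ‖v - u x‖ ^ 2 / (2 * θ x) ≤ Θ * (‖v‖ ^ 2 + V ^ 2) := by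
    have hux : ‖u x‖ ≤ V := hu x
    have hV : 0 ≤ V := (norm_nonneg _).trans hux
    have htri : ‖v - u x‖ ≤ ‖v‖ + ‖u x‖ := norm_sub_le v (u x)
    have h1 : ‖v - u x‖ ^ 2 ≤ (‖v‖ + ‖u x‖) ^ 2 := by gcongr
    have h2 : ‖u x‖ ^ 2 ≤ V ^ 2 := by gcongr
    have hsq : ‖v - u x‖ ^ 2 ≤ 2 * (‖v‖ ^ 2 + V ^ 2) := by
      nlinarith [h1, h2, sq_nonneg (‖v‖ - ‖u x‖)]
    rw [div_le_iff₀ (by positivity)]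
    calc ‖v - u x‖ ^ 2 ≤ 2 * (‖v‖ ^ 2 + V ^ 2) := hsq
      _ = Θ * (‖v‖ ^ 2 + V ^ 2) * (2 * Θ⁻¹) := by field_simp
      _ ≤ Θ * (‖v‖ ^ 2 + V ^ 2) * (2 * θ x) := by
          refine mul_le_mul_of_nonneg_left ?_ (by positivity)
          exact mul_le_mul_of_nonneg_left (hθ x).1 zero_le_two
  rw [MacroClosureLine.StubLedger.log_localGibbsProfile_eq x v hax hθx]
  have hAx := abs_le.1 hlA
  have hBx := abs_le.1 hB
  rw [abs_le]
  constructor <;> nlinarith [hAx.1, hAx.2, hBx.1, hBx.2, hQ, hQ0, mul_nonneg hΘ.le (sq_nonneg ‖v‖),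
    mul_nonneg hΘ.le (sq_nonneg V), mul_nonneg hlogA (sq_nonneg ‖v‖), mul_nonneg hlogΘ (sq_nonneg ‖v‖),
    mul_nonneg h2π (sq_nonneg ‖v‖), mul_nonneg (mul_nonneg hΘ.le (sq_nonneg V)) (sq_nonneg ‖v‖)]

/-- The `BlockGibbs` constant is nonnegative on the `BlockGibbs` range (`1 ≤ A`, `1 ≤ Θ`). [folklore] -/
theorem logProfileConst_nonneg {A Θ V : ℝ} (hA : 1 ≤ A) (hΘ : 1 ≤ Θ) :
    0 ≤ Real.log A + 3 / 2 * (Real.log (2 * Real.pi) + Real.log Θ) + Θ * (1 + V ^ 2) := by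
  have h2π : 0 ≤ Real.log (2 * Real.pi) := Real.log_nonneg (by linarith [Real.pi_gt_three])
  have := Real.log_nonneg hA
  have := Real.log_nonneg hΘ
  positivity

/-- **Integrability of the log-profile pairing along a measurable map** for measurable parameters in a
`BlockGibbs` range: if the kinetic energy `⟨emp (T z), |v|²⟩` is integrable under a finite law `P`, so
is `⟨emp (T ·), log prof⟩`, with `|∫ ⟨emp ∘ T, log prof⟩ dP| ≤ C (P(univ) + ∫ ⟨emp ∘ T, |v|²⟩ dP)`.
[folklore] -/
theorem integrable_logPair_comp_of_bounds {N : ℕ} {A Θ V : ℝ} (hA : 0 < A) (hΘ : 0 < Θ)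
    {a θ : T3 → ℝ} {u : T3 → V3} (ham : Measurable a) (hθm : Measurable θ) (hum : Measurable u)
    (ha : ∀ x, A⁻¹ ≤ a x ∧ a x ≤ A) (hθ : ∀ x, Θ⁻¹ ≤ θ x ∧ θ x ≤ Θ) (hu : ∀ x, ‖u x‖ ≤ V)
    {P : Measure (Config (N + 1) (Fin 3) T3)} [IsFiniteMeasure P]
    {T : Config (N + 1) (Fin 3) T3 → Config (N + 1) (Fin 3) T3} (hT : Measurable T)
    (hK : Integrable (fun z => ∫ y, ‖y.2‖ ^ 2 ∂(empiricalMeasure (T z))) P) :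
    Integrable (fun z => (∫ y, Real.log (localGibbsProfile a u θ y) ∂(empiricalMeasure (T z)))) P ∧
      |∫ z, (∫ y, Real.log (localGibbsProfile a u θ y) ∂(empiricalMeasure (T z))) ∂P| ≤
        (Real.log A + 3 / 2 * (Real.log (2 * Real.pi) + Real.log Θ) + Θ * (1 + V ^ 2)) *
          (P.real univ + ∫ z, (∫ y, ‖y.2‖ ^ 2 ∂(empiricalMeasure (T z))) ∂P) := by
  set C : ℝ := Real.log A + 3 / 2 * (Real.log (2 * Real.pi) + Real.log Θ) + Θ * (1 + V ^ 2) with hC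
  have hCpt := abs_log_localGibbsProfile_le_of_bounds hA hΘ ha hθ hu
  have hdom : Integrable (fun z => C * (1 + ∫ y, ‖y.2‖ ^ 2 ∂(empiricalMeasure (T z)))) P :=
    ((integrable_const (1 : ℝ)).add hK).const_mul C
  have hpt : ∀ z, |(∫ y, Real.log (localGibbsProfile a u θ y) ∂(empiricalMeasure (T z)))| ≤
      C * (1 + ∫ y, ‖y.2‖ ^ 2 ∂(empiricalMeasure (T z))) := fun z =>
    MacroClosureLine.StubLedger.abs_logPair_le hCpt (T z)
  have hint : Integrable (fun z => (∫ y, Real.log (localGibbsProfile a u θ y) ∂(empiricalMeasure (T z)))) P :=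
    hdom.mono' ((measurable_logPair' ham hθm hum).comp hT).aestronglyMeasurable
      (ae_of_all _ fun z => by rw [Real.norm_eq_abs]; exact hpt z)
  refine ⟨hint, ?_⟩
  calc |∫ z, (∫ y, Real.log (localGibbsProfile a u θ y) ∂(empiricalMeasure (T z))) ∂P|
      ≤ ∫ z, C * (1 + ∫ y, ‖y.2‖ ^ 2 ∂(empiricalMeasure (T z))) ∂P := by
        rw [← Real.norm_eq_abs]
        exact norm_integral_le_of_norm_le hdom (ae_of_all _ fun z => by rw [Real.norm_eq_abs]; exact hpt z)
    _ = C * (P.real univ + ∫ z, (∫ y, ‖y.2‖ ^ 2 ∂(empiricalMeasure (T z))) ∂P) := by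
        rw [integral_const_mul, integral_add (integrable_const _) hK, integral_const, smul_eq_mul, mul_one]

/-! ## Comparison of configurational partition functions -/

/-- **Log-partition comparison** (the price of changing the activity profile), `σ ≤ 1/2` form of
`JaynesSqueezeSqueeze.abs_log_posPartition_sub_le`: for measurable positive bounded activities with
`|log a − log b| ≤ η`, `|log Z_pos(a) − log Z_pos(b)| ≤ (N+1) η` for `N + 1` spheres of diameter
`hsDiameter σ N` (both partition functions are then positive, `posPartition_pos'`). [folklore] -/
theorem abs_log_posPartition_sub_le {a b : T3 → ℝ} (ham : Measurable a) (hbm : Measurable b)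
    (ha0 : ∀ x, 0 < a x) (hb0 : ∀ x, 0 < b x) {B : ℝ} (haB : ∀ x, a x ≤ B) (hbB : ∀ x, b x ≤ B) {η : ℝ}
    (h : ∀ x, |Real.log (a x) - Real.log (b x)| ≤ η) {σ : ℝ} (hσ2 : σ ≤ 1 / 2) (N : ℕ) :
    |Real.log (posPartition a (hsDiameter σ N) (N + 1)) - Real.log (posPartition b (hsDiameter σ N) (N + 1))| ≤
      ((N : ℝ) + 1) * η := by
  have h1 := JaynesSqueezeSqueeze.abs_log_posPartition_sub_le ham hbm ha0 hb0 haB hbB h (hsDiameter σ N) (N + 1)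
    (posPartition_pos' ham ha0 haB hσ2 N) (posPartition_pos' hbm hb0 hbB hσ2 N)
  push_cast at h1
  exact h1

/-! ## The block reference of `BlockGibbs` -/

section BlockRef

variable {a₀ θ₀ : T3 → ℝ} {u₀ : T3 → V3} {σ : ℝ} {N : ℕ} {A Θ V : ℝ}
  {ca cθ : (Fin 3 → ℕ) → ℝ} {cu : (Fin 3 → ℕ) → V3}

/-- **The block reference of `BlockGibbs` is a probability measure**: for block parameters in the
`BlockGibbs` range and `σ ≤ 1/2`, `localGibbsLaw σ (ca ∘ idx m) (cu ∘ idx m) (cθ ∘ idx m) N Φ` has total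
mass one (so the `klDiv` in `BlockGibbs` is a genuine relative entropy, never the junk `klDiv μ 0 = ∞`).
[folklore] -/
theorem isProbabilityMeasure_localGibbsLaw_blockRef (hA : 0 < A) (hΘ : 0 < Θ)
    (hR : ∀ k, A⁻¹ ≤ ca k ∧ ca k ≤ A ∧ Θ⁻¹ ≤ cθ k ∧ cθ k ≤ Θ ∧ ‖cu k‖ ≤ V) (hσ2 : σ ≤ 1 / 2) (N m : ℕ)
    (Φ : HardSphereFlow (Torus.geometry (Fin 3)) (hsDiameter σ N) (N + 1)) :
    IsProbabilityMeasure (localGibbsLaw σ (fun x => ca (fun i : Fin 3 => ⌊(m : ℝ) * Torus.repr x i⌋₊))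
      (fun x => cu (fun i : Fin 3 => ⌊(m : ℝ) * Torus.repr x i⌋₊))
      (fun x => cθ (fun i : Fin 3 => ⌊(m : ℝ) * Torus.repr x i⌋₊)) N Φ) :=
  isProbabilityMeasure_localGibbsLaw' (measurable_comp_blockIdx ca m) (measurable_comp_blockIdx cθ m)
    (measurable_comp_blockIdx cu m) (fun _ => (inv_pos.2 hA).trans_le (hR _).1) (fun _ => (hR _).2.1)
    (fun _ => (inv_pos.2 hΘ).trans_le (hR _).2.2.1) hσ2 N Φ

end BlockRef

end Summit.AtomisticToContinuum.HydrodynamicLimit.Theorems.BlockGibbsLine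

end
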